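import Mathlib
import Literature.NumberTheory.LFunctions.Zhang2022.Section17U021ChiR1Prelims
import HarnessLib

/-!
# Zhang (2022) §17.u021 (χ-twisted reading), remainder `R₁`: the PRIME WINDOW `m₂ = q > D⁴` —
# the exact shape of `ν₁*(l₂q)` (the `T²`-cutoff enters only through `g*(T²/(qb′))`, `b′ ∣ l₂`)

Topic `Literature/NumberTheory/LFunctions/Zhang2022` (Landau–Siegel audit tree; verdict-neutral).
Y. Zhang, *Discrete mean estimates and the Landau–Siegel zero*, arXiv:2211.02515v1 (2022)
[Zhang2022LandauSiegel] — **an unrefereed manuscript under adjudication; nothing here asserts or denies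
its Theorems 1–2, and no claim about Landau–Siegel zeros is made.** ZHANG-L discharge lane, WP16, R1-χ
sub-leaf under `Typed.Section17.Eq17_9RelE` (W16-S5d (F); owner zl-libB-p6 g2), node
`Typed.Section17.Step17_u021Chi` reduced by `Section17U021ChiDecomposition.step17_u021Chi_of_remainders`
to `R₁ = o(1)` (the `m₂ ≥ 2` terms; `R₂` landed). §17 p. 98 (tex L4825): "we can drop the terms with
`m₂ > 1` … with an acceptable error" — no bound in print.

In `R₁` the coefficient `ν₁*(l₂m₂)` (`ν₁* = υ·[≤D⁴] ∗ nN_{β₂} ∗ nN_{β₃}`, `nN_β(n) = n^{−β}g*(T²/n)`) is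
evaluated at `v = l₂m₂` up to `T⁵`, beyond the range `v ≤ D⁴` where `ν₁* = μχ∗1 + O(α𝓛)`
(`Phi3Eval.norm_nuOneStar_le`). For a PRIME `m₂ = q > D⁴` (so `q ∤ l₂`, `l₂ ≤ D⁴`) the truncation
`υ·[≤D⁴]` is invisible (every divisor `a ≤ D⁴` of `l₂q` divides `l₂`) and the `T²`-cutoff enters only
through the factors `g*(T²/(qb′))`, `b′ ∣ l₂`:

  `ν₁*(l₂q) = Σ_{b′c′ = l₂} nN_{β₂}(qb′)·(υ ∗ nN_{β₃})(c′) + Σ_{b′c′ = l₂} nN_{β₃}(qb′)·(υ ∗ nN_{β₂})(c′)`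

(`nuOneStar_mul_prime_eq`). This is the identity behind the "window" phenomenon of the R₁ analysis
(strike memo MEMO-R1-window.md §1: for a split prime `p` and `T²/p < q < T²`, `ν₁*(pq) ≈ −2`): after it,
the `q`-sum of `R₁` is taken FIRST, inside the `b′`-sum. Also recorded: the generic splitting of a
Dirichlet convolution at an argument `nq`, `q` prime, `q ∤ n` (`convolution_mul_prime_eq`).
Theorems only; no definitions; standard axioms.

## References

* Y. Zhang, arXiv:2211.02515v1 (2022), §17 p. 98 (u021), tex L4825; p. 97 (`ν₁*`, u014).
  [cite: Zhang2022LandauSiegel, §17 u021 p.98]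
-/

noncomputable section

open Complex Real ComplexConjugate Finset
open scoped LSeries.notation

namespace Literature.NumberTheory.LFunctions.Zhang2022.Typed.Section17

open Literature.NumberTheory.LFunctions.Zhang2022
open Literature.NumberTheory.LFunctions.Zhang2022.Skeleton

/-! ## Dirichlet convolutions at `n·q`, `q` prime, `q ∤ n` -/

/-- The divisor pairs of `mn`, `(m,n) = 1`, are the products of the divisor pairs of `m` and of `n`
(re-proved privately, as in `TypedSection15B`, to keep the import cone minimal). [folklore] -/
private theorem sum_divisorsAntidiagonal_mul_of_coprime {M : Type*} [AddCommMonoid M] {m n : ℕ}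
    (hmn : m.Coprime n) (f : ℕ × ℕ → M) :
    ∑ w ∈ (m * n).divisorsAntidiagonal, f w =
      ∑ x ∈ m.divisorsAntidiagonal, ∑ y ∈ n.divisorsAntidiagonal, f (x.1 * y.1, x.2 * y.2) := by
  rw [← Finset.sum_product']
  symm
  apply Finset.sum_nbij fun ((i, j), k, l) ↦ (i * k, j * l)
  · rintro ⟨⟨a1, a2⟩, ⟨b1, b2⟩⟩ h
    simp only [Nat.mem_divisorsAntidiagonal, Ne, Finset.mem_product] at h
    rcases h with ⟨⟨rfl, ha⟩, ⟨rfl, hb⟩⟩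
    simp only [Nat.mem_divisorsAntidiagonal, mul_eq_zero, Ne]
    constructor
    · ring
    rw [mul_eq_zero] at *
    exact not_or_intro ha hb
  · simp only [Set.InjOn, Finset.mem_coe, Nat.mem_divisorsAntidiagonal, Finset.mem_product, Prod.mk_inj]
    rintro ⟨⟨a1, a2⟩, ⟨b1, b2⟩⟩ ⟨⟨rfl, ha⟩, ⟨rfl, hb⟩⟩ ⟨⟨c1, c2⟩, ⟨d1, d2⟩⟩ hcd h
    have cop := hmn
    ext
    · trans Nat.gcd (a1 * a2) (a1 * b1)
      · rw [Nat.gcd_mul_left, cop.coprime_mul_left.coprime_mul_right_right.gcd_eq_one, mul_one]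
      · rw [← hcd.1.1, ← hcd.2.1] at cop
        rw [← hcd.1.1, h.1, Nat.gcd_mul_left,
          cop.coprime_mul_left.coprime_mul_right_right.gcd_eq_one, mul_one]
    · trans Nat.gcd (a1 * a2) (a2 * b2)
      · rw [mul_comm, Nat.gcd_mul_left, cop.coprime_mul_right.coprime_mul_left_right.gcd_eq_one,
          mul_one]
      · rw [← hcd.1.1, ← hcd.2.1] at cop
        rw [← hcd.1.1, h.2, mul_comm, Nat.gcd_mul_left,
          cop.coprime_mul_right.coprime_mul_left_right.gcd_eq_one, mul_one]
    · trans Nat.gcd (b1 * b2) (a1 * b1)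
      · rw [mul_comm, Nat.gcd_mul_right,
          cop.coprime_mul_right.coprime_mul_left_right.symm.gcd_eq_one, one_mul]
      · rw [← hcd.1.1, ← hcd.2.1] at cop
        rw [← hcd.2.1, h.1, mul_comm c1 d1, Nat.gcd_mul_left,
          cop.coprime_mul_right.coprime_mul_left_right.symm.gcd_eq_one, mul_one]
    · trans Nat.gcd (b1 * b2) (a2 * b2)
      · rw [Nat.gcd_mul_right, cop.coprime_mul_left.coprime_mul_right_right.symm.gcd_eq_one, one_mul]
      · rw [← hcd.1.1, ← hcd.2.1] at cop
        rw [← hcd.2.1, h.2, Nat.gcd_mul_right,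
          cop.coprime_mul_left.coprime_mul_right_right.symm.gcd_eq_one, one_mul]
  · simp only [Set.SurjOn, Set.subset_def, Finset.mem_coe, Nat.mem_divisorsAntidiagonal,
      Finset.mem_product, Set.mem_image]
    rintro ⟨b1, b2⟩ h
    use ((b1.gcd m, b2.gcd m), (b1.gcd n, b2.gcd n))
    rw [← hmn.gcd_mul _, ← hmn.gcd_mul _, ← h.1, Nat.gcd_mul_gcd_of_coprime_of_mul_eq_mul hmn h.1,
      Nat.gcd_mul_gcd_of_coprime_of_mul_eq_mul hmn.symm _]
    · rw [Ne, mul_eq_zero, not_or] at h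
      simp [h.2.1, h.2.2]
    rw [mul_comm n m, h.1]
  · rintro ⟨⟨a1, a2⟩, ⟨b1, b2⟩⟩ _
    rfl


/-- **A Dirichlet convolution at `n·q`, `q` prime, `q ∤ n`:** the divisor pairs of `nq` are
`(qx, y)` and `(x, qy)` with `xy = n`, so `(f ∗ g)(nq) = Σ_{xy=n} (f(qx)g(y) + f(x)g(qy))`.
[folklore] -/
private theorem convolution_mul_prime_eq {R : Type*} [CommSemiring R] (f g : ℕ → R) {n q : ℕ}
    (hq : q.Prime) (hqn : ¬ q ∣ n) :
    (f ⍟ g) (n * q) =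
      ∑ x ∈ n.divisorsAntidiagonal, (f (q * x.1) * g x.2 + f x.1 * g (q * x.2)) := by
  have hcop : n.Coprime q := (Nat.Prime.coprime_iff_not_dvd hq).mpr hqn |>.symm
  rw [LSeries.convolution_def]
  dsimp only
  rw [sum_divisorsAntidiagonal_mul_of_coprime hcop]
  refine Finset.sum_congr rfl fun x _ => ?_
  rw [Nat.sum_divisorsAntidiagonal (f := fun a b => f (x.1 * a) * g (x.2 * b)), Nat.Prime.divisors hq,
    Finset.sum_pair hq.one_lt.ne, Nat.div_one, Nat.div_self hq.pos]
  simp only [mul_one, mul_comm x.1 q, mul_comm x.2 q, add_comm]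

/-- **The inner truncated convolution at `q·x`, `q > D⁴` prime, `x ≤ D⁴`:** the pairs `(qa, b)` have
`qa > D⁴` (killed by the truncation) and on the pairs `(a, qb)` the truncation is invisible, so
`(υ·[≤D⁴] ∗ h)(qx) = (υ ∗ h(q·))(x)`. [folklore] -/
private theorem convolution_trunc_mul_prime_eq (h : ℕ → ℂ) {D : ℕ} (χ : DirichletCharacter ℂ D) {x q : ℕ}
    (hq : q.Prime) (hqD : D ^ 4 < q) (hx : x ≤ D ^ 4) (hx0 : x ≠ 0) :
    (trunc (D ^ 4) (ups χ) ⍟ h) (q * x) = (ups χ ⍟ fun b => h (q * b)) x := by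
  have hqx : ¬ q ∣ x := fun hd => absurd (Nat.le_of_dvd (Nat.pos_of_ne_zero hx0) hd) (by omega)
  rw [mul_comm q x, convolution_mul_prime_eq _ _ hq hqx,
    congrFun (LSeries.convolution_def (ups χ) fun b => h (q * b)) x]
  refine Finset.sum_congr rfl fun y hy => ?_
  have hy1 : y.1 ≠ 0 := by
    have := Nat.mem_divisorsAntidiagonal.mp hy
    exact left_ne_zero_of_mul (this.1 ▸ this.2)
  have hle : y.1 ≤ D ^ 4 := (Nat.divisor_le (Nat.fst_mem_divisors_of_mem_antidiagonal hy)).trans hx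
  have hbig : ¬ q * y.1 ≤ D ^ 4 := by
    have : q ≤ q * y.1 := Nat.le_mul_of_pos_right q (Nat.pos_of_ne_zero hy1)
    omega
  simp [trunc, hbig, hle]

/-- On arguments `≤ D⁴` the truncation is invisible: for `x ≤ D⁴`, `(υ·[≤D⁴] ∗ h)(x) = (υ ∗ h)(x)`.
[folklore] -/
private theorem convolution_trunc_eq_of_le (h : ℕ → ℂ) {D : ℕ} (χ : DirichletCharacter ℂ D) {x : ℕ}
    (hx : x ≤ D ^ 4) :
    (trunc (D ^ 4) (ups χ) ⍟ h) x = (ups χ ⍟ h) x := by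
  rw [LSeries.convolution_def, LSeries.convolution_def]
  refine Finset.sum_congr rfl fun y hy => ?_
  have hle : y.1 ≤ D ^ 4 := (Nat.divisor_le (Nat.fst_mem_divisors_of_mem_antidiagonal hy)).trans hx
  simp [trunc, hle]

/-- Associativity/commutativity of Dirichlet convolution as functions: `(a ∗ b) ∗ c = b ∗ (a ∗ c)`.
[folklore] -/
private theorem convolution_left_comm (a b c : ℕ → ℂ) : (a ⍟ b) ⍟ c = b ⍟ (a ⍟ c) := by
  have h1 : toArithmeticFunction (a ⍟ b) = toArithmeticFunction a * toArithmeticFunction b := by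
    ext n
    rcases eq_or_ne n 0 with rfl | hn
    · simp [toArithmeticFunction]
    · simp [toArithmeticFunction, hn, LSeries.convolution]
  have h2 : toArithmeticFunction (a ⍟ c) = toArithmeticFunction a * toArithmeticFunction c := by
    ext n
    rcases eq_or_ne n 0 with rfl | hn
    · simp [toArithmeticFunction]
    · simp [toArithmeticFunction, hn, LSeries.convolution]
  change ⇑(toArithmeticFunction (a ⍟ b) * toArithmeticFunction c) =
    ⇑(toArithmeticFunction b * toArithmeticFunction (a ⍟ c))
  rw [h1, h2]
  congr 1
  ring

/-! ## The exact shape of `ν₁*(l₂q)` for a prime `q > D⁴` -/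

/-- **`ν₁*(nq)` for a prime `q > D⁴` and `1 ≤ n ≤ D⁴`** (so `q ∤ n`): with `ρ_j := υ ∗ nN_{β_j}`,
`ν₁*(nq) = Σ_{b′c′=n} nN_{β₂}(qb′)·ρ₃(c′) + Σ_{b′c′=n} nN_{β₃}(qb′)·ρ₂(c′)` — the `D⁴`-truncation of `υ`
disappears (the divisors `a ≤ D⁴` of `nq` are the divisors of `n`) and the `T²`-cutoff survives only in
`nN_{β_j}(qb′) = (qb′)^{−β_j}g*(T²/(qb′))`. [cite: Zhang2022LandauSiegel, §17 p.97 (ν₁*), p.98 u021] -/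
theorem nuOneStar_mul_prime_eq (c' : ℝ) {D : ℕ} (χ : DirichletCharacter ℂ D) {n q : ℕ}
    (hq : q.Prime) (hqD : D ^ 4 < q) (hn : n ≤ D ^ 4) (hn0 : n ≠ 0) :
    nuOneStar c' χ (n * q) =
      (∑ y ∈ n.divisorsAntidiagonal,
          nN D (beta2 c' D) (q * y.1) * (ups χ ⍟ nN D (beta3 c' D)) y.2) +
        ∑ y ∈ n.divisorsAntidiagonal,
          nN D (beta3 c' D) (q * y.1) * (ups χ ⍟ nN D (beta2 c' D)) y.2 := by
  have hqn : ¬ q ∣ n := fun h => absurd (Nat.le_of_dvd (Nat.pos_of_ne_zero hn0) h) (by omega)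
  set N₂ : ℕ → ℂ := nN D (beta2 c' D) with hN₂
  set N₃ : ℕ → ℂ := nN D (beta3 c' D) with hN₃
  set N₂q : ℕ → ℂ := fun b => N₂ (q * b) with hN₂q
  -- `ν₁* = (υ_T ∗ N₂) ∗ N₃`
  have hdef : nuOneStar c' χ = (trunc (D ^ 4) (ups χ) ⍟ N₂) ⍟ N₃ := rfl
  rw [hdef, convolution_mul_prime_eq _ _ hq hqn, Finset.sum_add_distrib]
  congr 1
  · -- the pairs `(qx, y)`: `(υ_T ∗ N₂)(qx) = (υ ∗ N₂(q·))(x)`, then re-associate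
    have e1 : ∑ y ∈ n.divisorsAntidiagonal, (trunc (D ^ 4) (ups χ) ⍟ N₂) (q * y.1) * N₃ y.2 =
        ∑ y ∈ n.divisorsAntidiagonal, (ups χ ⍟ N₂q) y.1 * N₃ y.2 := by
      refine Finset.sum_congr rfl fun y hy => ?_
      have hy1 : y.1 ≠ 0 := by
        have := Nat.mem_divisorsAntidiagonal.mp hy
        exact left_ne_zero_of_mul (this.1 ▸ this.2)
      have hle : y.1 ≤ D ^ 4 :=
        (Nat.divisor_le (Nat.fst_mem_divisors_of_mem_antidiagonal hy)).trans hn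
      rw [convolution_trunc_mul_prime_eq N₂ χ hq hqD hle hy1]
    have e2 : ((ups χ ⍟ N₂q) ⍟ N₃) n = ∑ y ∈ n.divisorsAntidiagonal, (ups χ ⍟ N₂q) y.1 * N₃ y.2 :=
      congrFun (LSeries.convolution_def (ups χ ⍟ N₂q) N₃) n
    have e3 : (N₂q ⍟ (ups χ ⍟ N₃)) n = ∑ y ∈ n.divisorsAntidiagonal, N₂q y.1 * (ups χ ⍟ N₃) y.2 :=
      congrFun (LSeries.convolution_def N₂q (ups χ ⍟ N₃)) n
    rw [e1, ← e2, convolution_left_comm, e3]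
  · -- the pairs `(x, qy)`: `(υ_T ∗ N₂)(x) = ρ₂(x)` since `x ≤ n ≤ D⁴`; then swap the pair
    rw [Nat.sum_divisorsAntidiagonal' (f := fun a b => (trunc (D ^ 4) (ups χ) ⍟ N₂) a * N₃ (q * b)),
      Nat.sum_divisorsAntidiagonal (f := fun a b => N₃ (q * a) * (ups χ ⍟ N₂) b)]
    refine Finset.sum_congr rfl fun i hi => ?_
    have hle : n / i ≤ D ^ 4 := (Nat.div_le_self n i).trans hn
    rw [convolution_trunc_eq_of_le N₂ χ hle, mul_comm]


/-! ## The log-twisted convolution: `(f·log) ∗ ρ = (Λ·f) ∗ (f ∗ ρ)` for completely multiplicative `f`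

This is the identity behind the `Λ = log ∗ μ` phenomenon of the window analysis (MEMO-R1-window §3(β)):
after the `q`-sum is taken first, the `b′`-sum of the window term carries the weight `log b′`, and
`Σ_{b′c′ = l₂} f(b′)·log b′·ρ(c′) = Σ_{d ∣ l₂} Λ(d) f(d)·(f ∗ ρ)(l₂/d)` — supported, up to the factor
`(f ∗ ρ)(l₂/d)`, on the prime-power divisors `d` of `l₂`. -/

/-- Re-association of a double divisor-pair sum (the sum over triples `d·e·c = n` grouped as
`(de)·c` or as `d·(ec)`) — the bookkeeping of `ArithmeticFunction.mul_smul'`. [folklore] -/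
private theorem sum_divisorsAntidiagonal_assoc {M : Type*} [AddCommMonoid M] (G : ℕ → ℕ → ℕ → M) (n : ℕ) :
    ∑ x ∈ n.divisorsAntidiagonal, ∑ y ∈ x.1.divisorsAntidiagonal, G y.1 y.2 x.2 =
      ∑ x ∈ n.divisorsAntidiagonal, ∑ y ∈ x.2.divisorsAntidiagonal, G x.1 y.1 y.2 := by
  rw [Finset.sum_sigma', Finset.sum_sigma']
  apply Finset.sum_nbij' (fun ⟨⟨_b, c⟩, ⟨d, e⟩⟩ ↦ ⟨(d, e * c), (e, c)⟩)
    (fun ⟨⟨d, _m⟩, ⟨e, c⟩⟩ ↦ ⟨(d * e, c), (d, e)⟩) <;> aesop (add simp mul_assoc)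

/-- **`Σ_{bc=n} f(b) log b ρ(c) = Σ_{de=n} Λ(d) f(d) (f ∗ ρ)(e)`** for `f` completely multiplicative
(`f(xy) = f(x)f(y)`): write `log b = Σ_{d∣b} Λ(d)` and regroup `b = d·b″` — the `Λ = log ∗ μ`
bookkeeping behind the `T²`-window of §17.u021's remainder `R₁`. [cite: Zhang2022LandauSiegel, §17 u021 p.98] -/
theorem sum_divisorsAntidiagonal_mul_log_eq {f : ℕ → ℂ} (hf : ∀ x y, f (x * y) = f x * f y)
    (ρ : ℕ → ℂ) (n : ℕ) :
    ∑ x ∈ n.divisorsAntidiagonal, f x.1 * Real.log x.1 * ρ x.2 =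
      ∑ x ∈ n.divisorsAntidiagonal,
        (ArithmeticFunction.vonMangoldt x.1 : ℂ) * f x.1 * (f ⍟ ρ) x.2 := by
  classical
  -- `log b = Σ_{de = b} Λ(d)`, complexified
  have hlog : ∀ b : ℕ, (Real.log b : ℂ) =
      ∑ y ∈ b.divisorsAntidiagonal, (ArithmeticFunction.vonMangoldt y.1 : ℂ) := by
    intro b
    rw [Nat.sum_divisorsAntidiagonal (f := fun a _ => (ArithmeticFunction.vonMangoldt a : ℂ)),
      ← ArithmeticFunction.vonMangoldt_sum, Complex.ofReal_sum]
  calc ∑ x ∈ n.divisorsAntidiagonal, f x.1 * Real.log x.1 * ρ x.2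
      = ∑ x ∈ n.divisorsAntidiagonal, ∑ y ∈ x.1.divisorsAntidiagonal,
          (ArithmeticFunction.vonMangoldt y.1 : ℂ) * f (y.1 * y.2) * ρ x.2 := by
        refine Finset.sum_congr rfl fun x _ => ?_
        rw [hlog x.1, Finset.mul_sum, Finset.sum_mul]
        refine Finset.sum_congr rfl fun y hy => ?_
        rw [(Nat.mem_divisorsAntidiagonal.mp hy).1]
        ring
    _ = ∑ x ∈ n.divisorsAntidiagonal, ∑ y ∈ x.2.divisorsAntidiagonal,
          (ArithmeticFunction.vonMangoldt x.1 : ℂ) * f (x.1 * y.1) * ρ y.2 :=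
        sum_divisorsAntidiagonal_assoc
          (fun d e c => (ArithmeticFunction.vonMangoldt d : ℂ) * f (d * e) * ρ c) n
    _ = ∑ x ∈ n.divisorsAntidiagonal,
          (ArithmeticFunction.vonMangoldt x.1 : ℂ) * f x.1 * (f ⍟ ρ) x.2 := by
        refine Finset.sum_congr rfl fun x _ => ?_
        rw [congrFun (LSeries.convolution_def f ρ) x.2]
        simp only [Finset.mul_sum]
        refine Finset.sum_congr rfl fun y _ => ?_
        rw [hf]
        ring

/-- Consequently `‖Σ_{bc=n} f(b) log b ρ(c)‖ ≤ Σ_{de=n} Λ(d)·‖(f ∗ ρ)(e)‖` when `‖f‖ ≤ 1`: the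
log-weighted convolution is controlled by `Λ ∗ ‖f ∗ ρ‖`, i.e. by the values of `f ∗ ρ` at the
co-prime-power parts of `n` (window bookkeeping of §17.u021's `R₁`). [cite: Zhang2022LandauSiegel, §17 u021 p.98] -/
theorem norm_sum_divisorsAntidiagonal_mul_log_le {f : ℕ → ℂ} (hf : ∀ x y, f (x * y) = f x * f y)
    (hf1 : ∀ x, ‖f x‖ ≤ 1) (ρ : ℕ → ℂ) (n : ℕ) :
    ‖∑ x ∈ n.divisorsAntidiagonal, f x.1 * Real.log x.1 * ρ x.2‖ ≤
      ∑ x ∈ n.divisorsAntidiagonal, ArithmeticFunction.vonMangoldt x.1 * ‖(f ⍟ ρ) x.2‖ := by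
  rw [sum_divisorsAntidiagonal_mul_log_eq hf ρ n]
  refine (norm_sum_le _ _).trans (Finset.sum_le_sum fun x _ => ?_)
  rw [norm_mul, norm_mul, Complex.norm_real, Real.norm_of_nonneg ArithmeticFunction.vonMangoldt_nonneg]
  calc ArithmeticFunction.vonMangoldt x.1 * ‖f x.1‖ * ‖(f ⍟ ρ) x.2‖
      ≤ ArithmeticFunction.vonMangoldt x.1 * 1 * ‖(f ⍟ ρ) x.2‖ := by
        gcongr
        exact hf1 _
    _ = _ := by rw [mul_one]

end Literature.NumberTheory.LFunctions.Zhang2022.Typed.Section17
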